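import Literature.MathematicalPhysics.QuantumLattice.HubbardFermiSeaTangentRowsDiluteFarPlanes
import Summits.Ventures.CertifiedManyBodySolver.Certificates.HubbardTTPrime_polarizedBandCaps_kernelC
import Summits.Ventures.CertifiedManyBodySolver.Observables.PhaseSeparationExclusionBox
import Summits.Ventures.CertifiedManyBodySolver.Observables.PhaseSeparationExclusionBoxZeemanTcap
import Summits.Ventures.CertifiedManyBodySolver.Observables.PhaseSeparationExclusionFarPlanesStrip
import Summits.Ventures.CertifiedManyBodySolver.Observables.PhaseSeparationExclusionNearStripElectronSideColumns
import Summits.Ventures.CertifiedManyBodySolver.Observables.PhaseSeparationExclusionQuarterConvexFloorB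
import Summits.Ventures.CertifiedManyBodySolver.Observables.PhaseSeparationExclusionTPrimeStripEXT5
import Summits.Ventures.CertifiedManyBodySolver.Observables.PhaseSeparationExclusionTPrimeStripXU
import Summits.Ventures.CertifiedManyBodySolver.Observables.PhaseSeparationExclusionWitnessSplitCap597
import HarnessLib
import HarnessLib.Audit

/-!
# Ventures/CertifiedManyBodySolver — Observables/PhaseSeparationExclusionNearStripCVBAxesHDE.lean: `(≤ 9/20 ∣ ≥ 1)` — no macroscopic coexistence of the half-filled-or-denser parent with a phase of hole doping ≥ 0.55 — on the cuprate strip: the `T = 0` FIELD axis (every `|h| ≤ h₀·t`) («THE #674 COLUMN», hubbard-downfold-unc-2 g36)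

«THE #674 COLUMN» edition (hubbard-downfold-unc-2 g36, generator `gen-g36/yb/gen36.py` over the g31–g35 generators): identical to the g35 FILLING-CONVEXITY-FLOOR edition except that the `U = 10` QUARTER-FILLING column is the `t′`-chord of the NEW certified row #674 `(10,½,−3/10) ≥ −0.9178863326` (`Certificates/HubbardSquare_U10_n1o2_tpm3o10_lower_row674.lean`, hubbard-algo-eng-8 twin-chain, tree 2026-08-30T04:04Z) and #607 `(10,½,0) ≥ −1.0777526533` — `hw_half_col10b` = `−1.0778 − 0.5329·s` (`+0.0092 ∣ +0.0077 ∣ +0.0061` over g35's #606-carried `hw_half_col10` at `s = −3/10 ∣ −1/4 ∣ −1/5`), its `U`-chord with `hw_half_col8` on `[8,10]` (`hw_half_floor810bAt`) (`Observables/PhaseSeparationExclusionQuarterConvexFloorB.lean`, this seat g36); for `(≤ 9/20 ∣ ≥ 1)` the DILUTE FLOOR at `n₁ = 9/20` is that column extrapolated down the density by convexity of `n ↦ e` against the WS597 filling-`3/4` plane or a kernel `5/8`-polarised cap at the same `(s, U₁)` (`dilute_floor_of_halfFloor_of_cap`, g35). Registry rows #674/#607 (and #606/#576 on `[8,10]`)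 enter as claim nodes BY NAME (`h674`/`h607`/`h606`/`h576`). Theorem names `cx…_9o20_…`.
HONEST FRAMING: first certified bounds; not a superconductivity verdict. CLASS = DERIVED / CONTEXT (competing-order words, CONTROL class: the excluded partner phase has
hole doping `≥ 11/20`). PURPOSE: the temperature / field / chemical-potential / interlayer ROBUSTNESS annex of the phase maps (D-0098) on the La-214 strip `t′ ∈ [−3/10,−1/5]`
(La₂₋ₓSrₓCuO₄ La214E ×10 `[−0.3,−0.2] × [5.9,14.7]` — its binding cells are the thin top cells `Q × [12,14] ∣ [14,16] ∣ [12,16]`, whose exact `T = 0` margins the new column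
roughly doubles: `(≤1/2∣≥1)` `0.0036 ∣ 0.0045 ∣ 0.0036 → 0.0082 ∣ 0.0091 ∣ 0.0082`, `(≤9/20∣≥1)` `0.0080 ∣ 0.0057 ∣ 0.0080 → 0.0130 ∣ 0.0116 ∣ 0.0130`). Laws (this seat g22–g26/g32/g33):
`psT_not_thermal_mix_on_cell_of_columns_hotAnchorSS_tcap` (canonical sector-Gibbs torus limits, every `β ≥ β₀`), `psHT_not_fieldEquilibrium_mix_on_cell_of_columns_hotAnchorSS_tcap` /
`psH_not_fieldGroundState_mix_on_cell_of_columns_tcap` (field), `psGCT_not_equilibrium_…` / `psGC_gap_on_cell_of_columns_tcap` (μ), `psL_not_layeredGroundState_mix_on_cell_of_columns_tcap`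
(interlayer), `…doccAnchor_tcap` (Mott anchor); CAP per cell = the WS597 witness-split plane of the certified #597 state at filling `3/4` (`wsplit597_cap_tcap_on_cell`, claim node
`cert_plaqseam_W4split597_TBD_allmk` BY NAME; valid for every `s ≤ 0`, `U ≥ 0`) or a kernel `5/8`-polarised band cap (`U`-independent, no claim node) — named per theorem with the
exact column margins; the generator asserts every inequality in exact rationals and the kernel re-checks by `nlinarith`. Cells in this file: `cxH_9o20_D_10to12_h1o20` [10,12].
WHAT THIS IS NOT: a certificate or number of record; CONTROL-class words conditional BY NAME (WS597 #634–#636, quarter-filling rows #674/#607/#606/#576, K2DIAG / registry nodes of the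
column laws, the hubbard-thermal-eng-4 Markov claim nodes where a HOT anchor is named) and BY VALUE (B54/B67c/B85c 10-dp floors, EXT5 / XU `n`-sheets) exactly as printed in each signature;
canonical / field / grand-canonical / layered equilibria as variational notions (existence not claimed); nothing at `t′ > 0` or `t′ < −3/10`; nothing about stripes as states,
ferromagnetism, superconductivity or `T_c`.

Seat hubbard-downfold-unc-2 g36 (`prover-hubbard-downfold-unc-2-g36-0`); generator `pub/hubbard-downfold/hubbard-downfold-unc-2/gen-g36/yb/gen36.py` (mode `axes0`, sentence `9o20`; exact `fractions`).
[cite: Israel1979, Thm. I.2.4] [cite: EmeryKivelsonLin1990, pp. 475–476] [cite: PoulinHastings2011, eqs. (3)–(8)] [cite: Griffiths1966, §II] [cite: Ruelle1969, §3.4] [cite: Israel1979, Thm. I.2.4] [cite: LiebPRL1989, proof of Theorem 1] [cite: PoulinHastings2011, eqs. (3)–(8)] [cite: Griffiths1964, §II] [cite: Israel1979, Thm. I.2.4] [cite: Griffiths1966, §II] [cite: PoulinHastings2011, eqs. (3)–(8)] [cite: Ruelle1969, §3.4] [cite: BratteliKishimotoRobinson1978, Thm. 2 (condition 2)] [cite: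 Lieb1973, §V (5.2)–(5.4)] [cite: LiebLoss1993, §8, Theorem 8.2] [cite: Griffiths1966, §II]
-/

noncomputable section

namespace Summit.Ventures.CertifiedManyBodySolver.Observables

open Summit.Ventures.CertifiedManyBodySolver.Certificates Summit.Ventures.CertifiedManyBodySolver.Downfold
open Literature.MathematicalPhysics.QuantumLattice Literature.MathematicalPhysics.QuantumLattice.ThermodynamicLimit
open Literature.MathematicalPhysics.QuantumLattice.InfVolFermionState Set Filter

/-- **`(≤ 9/20 | ≥ 1)` IN THE FIELD, `T = 0`: segment D `t′ ∈ [-3 / 10, -1 / 4] × U ∈ [10, 12]`, every `|h| ≤ 1/20·t`** (`≈ 380 T` at `t = 0.44 eV`;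
cap = the registry WITNESS-SPLIT plane of the CERTIFIED #597 state at filling `3/4` (rows #634–#636, claim node `cert_plaqseam_W4split597_TBD_allmk` BY NAME; `wsplit597_cap_tcap_on_cell`, hubbard-box-p3 g34: `e(1,s,U,3/4) ≤ −1.12227 − 0.30531·s + 0.02875·U`) at filling `3 / 4`, field cost `1/20·3 / 4 = 0.0375` against the column margins `U = 10`: M 0.0660∣0.0616; `U = 12`: M 0.0439∣0.0401; `n = 1` columns `es_n1_col10_d30` ∣ `ext5_n1_col12_d30` BY NAME):
no `(≤ 9/20 ∣ ≥ 1)` mixture of translation-invariant states is a ground state of `H(1,s,U) − h·(N↑ − N↓)` at its filling. [cite: Israel1979, Thm. I.2.4] [cite: Griffiths1964, Appendix] [cite: EmeryKivelsonLin1990, pp. 475–476] -/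
theorem cxH_9o20_D_10to12_h1o20 (h597 : cert_plaqseam_W4split597_TBD_allmk) (h674 : cert_r674_bs_GU10n1o2tpm3o10_w3_b4_R2_ob5p2_kry1_kry2c3rel_hanK7B4D4_KN4_PR20d4_hanK8c2s_uprime) (h607 : cert_r607_bs_GU10n1o2tp0_w3_b4_R2_ob5p2_kry1_kry2c3rel_hanK7B4D4_KN4_PR20d4_hanK8c2s_uprime) (hB85c : ((-1146707279/2500000000 : ℚ) : ℝ) ≤ energyDensityTT' 1 (3 / 10) 10 1) (hsX12m30n1 : ∀ m : ℝ, 0 ≤ m → m < 2 → (((-42844153095356934828307559/6044629098073145873530880 : ℚ)) : ℝ) + (((3680165511067/549755813888 : ℚ)) : ℝ) * m ≤ energyDensityTT' 1 (-3/10) (12) m) (h489 : cert_r489_hubSQ_hanK7R6_U12_r5_e4_so4blk)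
    {s : ℝ} (hs : s ∈ Icc (-3 / 10 : ℝ) (-1 / 4)) {U : ℝ} (hU : U ∈ Icc (10 : ℝ) (12))
    {hz : ℝ} (hh : |hz| ≤ 1 / 20)
    {ω₁ ω₂ : InfVolFermionState 2} (h₁ : ω₁.IsTranslationInvariant) (h₂ : ω₂.IsTranslationInvariant)
    (hρ₁ : 0 < ω₁.density) (hρ₁' : ω₁.density ≤ 9 / 20) (hρ₂ : 1 ≤ ω₂.density) (hρ₂' : ω₂.density < 2)
    {lam : ℝ} (hl0 : 0 < lam) (hl1 : lam < 1) :
    (gcInteractionTT' 1 s U 0 hz).tiGroundEnergyDensityAt 1 (mix lam hl0.le hl1.le ω₁ ω₂).density <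
      (mix lam hl0.le hl1.le ω₁ ω₂).meanEnergy (gcInteractionTT' 1 s U 0 hz) 1 := by
  refine psH_not_fieldGroundState_mix_on_cell_of_columns_tcap 1 (s₁ := -3 / 10) (s₂ := -1 / 4) (U₁ := 10) (U₂ := 12)
    (n₁ := 9 / 20) (n₂ := 1) (a := 5 / 11) (b := 6 / 11) (c₀ := ((-2467887174335/2199023255552 : ℚ) : ℝ)) (cs := ((-1342778035095/4398046511104 : ℚ) : ℝ)) (c₁ := ((252892912483/8796093022208 : ℚ) : ℝ)) (h₀ := 1 / 20)
    (by norm_num) (by norm_num) (by norm_num) (by norm_num) (by norm_num) (by norm_num) (by norm_num) (by norm_num)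
    (wsplit597_cap_tcap_on_cell h597 (by norm_num) (by norm_num) (by norm_num))
    (fun s hs => es_n1_col10_d30 hB85c s ⟨hs.1.trans' (by norm_num), hs.2.trans (by norm_num)⟩)
    (fun s hs => ext5_n1_col12_d30 hsX12m30n1 h489 s ⟨hs.1.trans' (by norm_num), hs.2.trans (by norm_num)⟩)
    (fun s hs U hU => dilute_floor_of_halfFloor_of_cap (U₀ := 10) (n₁ := 9 / 20) (n₀ := 5 / 8) (by norm_num) (by norm_num) (by norm_num) (by norm_num) (by norm_num)
      (fun s hs => (energyDensityTT'_anchor_le 1 s (n := 1 / 2) (by norm_num) (by norm_num) (U₀ := 10) (by norm_num) (by norm_num) (hw_half_col10b h674 h607 s ⟨hs.1.trans' (by norm_num), hs.2.trans (by norm_num)⟩)))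
      (fun s hs => pol5o8_m30m20 (U := 10) (by norm_num) (le_trans (by norm_num) hs.1) (hs.2.trans (by norm_num))) s hs U hU.1)
    hh ?_ ?_ hs hU h₁ h₂ hρ₁ hρ₁' hρ₂ hρ₂' hl0 hl1
  · intro s hs; obtain ⟨h1, h2⟩ := hs; push_cast; norm_num; nlinarith [h1, h2]
  · intro s hs; obtain ⟨h1, h2⟩ := hs; push_cast; norm_num; nlinarith [h1, h2]

end Summit.Ventures.CertifiedManyBodySolver.Observables

end
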